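import Literature.NumberTheory.DiophantineApproximation.RidoutAssembly

/-!
# The `p`-adic Roth theorem over `ℚ` (Ridout) — V. One class with a partial archimedean share

`Ridout.false_of_class_abs`: the class contradiction `Ridout.false_of_class` of
`RidoutAssembly.lean` (Bombieri–Gubler [BombieriGubler2006] 6.2.9 Steps I–V and §6.4 over `ℚ`
with the places `S ∪ {∞}`, after Schmidt [Schmidt1980] Ch. V §11) with a PARTIAL archimedean
share: for a finite set of primes `S`, roots `θ_p ∈ \overline{ℚ_p}` of monic `Q_p ∈ ℤ[X]`
(`p ∈ S`), `c₀ ≥ 1`, `ε > 0`, `μ ≥ 0`, `ν_p ≥ 0` with `μ + Σ_p ν_p ≥ 2 + ε/2`, there is NO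
unlimited supply (arbitrarily large denominators) of rationals `ρ` with `|ρ| ≤ c₀ den(ρ)^{-μ}`
and `min(1, |ρ − θ_p|_p) ≤ den(ρ)^{-ν_p}` (`p ∈ S`). The tree's `false_of_class` is `μ = 1`,
`ν_p = (1+ε)λ_p`; the present form (the place `∞` as one more coordinate of Mahler's classes) is
the one behind B–G Thm. 6.2.3 over `ℚ` with `α_∞ = 0`. The proof is that of `false_of_class`
verbatim (`ε₁, m, ω, B, C₁ = log(4Bc₀)`, the chain, Schmidt's degrees, the several-targets Index
Theorem, Roth's Lemma, the product formula), the archimedean Taylor estimate being run with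
`|ρ_h| ≤ c₀ q_h^{-μ}` (factor `e^{-μ w₀ W}`) and the `p`-adic ones with the exponents `ν_p`; the
exponent `m r₁ C₁ − μ W w₀ + m(1+ε₁)W − (Σ_p ν_p) W w₀` is negative (`exponent_neg_abs`).

NOT here: the passage to the finiteness theorem (Mahler's classes, B–G 6.2.3) and the
integer-target forms (`RidoutIntegers.lean`, `PadicRothIntegers.lean`).

## References

* [BombieriGubler2006] E. Bombieri, W. Gubler, *Heights in Diophantine Geometry*, CUP 2006,
  Thm. 6.2.3, 6.2.9, §6.4, 6.2.5–6.2.6.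
* [Schmidt1980] W. M. Schmidt, *Diophantine Approximation*, LNM 785, Springer 1980, Ch. V §11.
* [Ridout1958] D. Ridout, *The `p`-adic generalization of the Thue–Siegel–Roth theorem*,
  Mathematika 5 (1958) 40–48.
-/

noncomputable section

open MvPolynomial Finset Real
open scoped Polynomial

namespace Literature.NumberTheory.DiophantineApproximation

namespace Ridout

open Literature.NumberTheory.DiophantineGeometry.Roth

/-- **The exponent is negative** (B–G Step V for the parameters of `false_of_class_abs`): with
`ε₁ ≤ min(ε,1)/40`, `w₀ ≥ (m/2)(1-2ε₁) ≥ 0`, `μ + Λ ≥ 2 + ε/2`, `ε L > 8(C₁ + 1)`, `C₁ ≥ 0`, the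
exponent `m r₁ C₁ − μ W w₀ + m(1+ε₁)W − Λ W w₀` (`W = r₁ L`) is negative. [folklore] -/
theorem exponent_neg_abs {m r₁ : ℕ} (hm : 2 ≤ m) (hr₁ : 0 < r₁) {ε ε₁ C₁ L Λ μ w₀ : ℝ}
    (hε : 0 < ε) (hε₁0 : 0 < ε₁) (hε₁ε : ε₁ ≤ ε / 40) (hε₁1 : ε₁ ≤ 1 / 40) (hC₁ : 0 ≤ C₁)
    (hL : 8 * (C₁ + 1) < ε * L) (hL0 : 0 < L) (hΛ : 2 + ε / 2 ≤ μ + Λ)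
    (hw₀low : (m : ℝ) / 2 * (1 - 2 * ε₁) ≤ w₀) (hw₀0 : 0 ≤ w₀) :
    ((m * r₁ : ℕ) : ℝ) * C₁ - μ * (r₁ * L) * w₀ + m * ((1 + ε₁) * (r₁ * L)) -
      Λ * (r₁ * L) * w₀ < 0 := by
  have hmR : (2 : ℝ) ≤ m := by exact_mod_cast hm
  have hr₁R : (0 : ℝ) < r₁ := by exact_mod_cast hr₁
  set W : ℝ := r₁ * L with hW
  have hW0 : 0 < W := mul_pos hr₁R hL0
  have hmr : ((m * r₁ : ℕ) : ℝ) = (m : ℝ) * r₁ := by push_cast; ring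
  rw [hmr]
  -- `W w₀ (μ + Λ) ≥ W (m/2)(1-2ε₁) (2 + ε/2)`
  have hkey : W * ((m : ℝ) / 2 * (1 - 2 * ε₁)) * (2 + ε / 2) ≤ W * w₀ * (μ + Λ) := by
    have h1 : ((m : ℝ) / 2 * (1 - 2 * ε₁)) * (2 + ε / 2) ≤ w₀ * (μ + Λ) :=
      mul_le_mul hw₀low hΛ (by positivity) hw₀0
    have := mul_le_mul_of_nonneg_left h1 hW0.le
    linarith [this]
  -- `3 ε₁ + ε₁ ε / 2 - ε/4 ≤ -13 ε / 80`
  have hbr : 3 * ε₁ + ε₁ * ε / 2 - ε / 4 ≤ -(13 * ε / 80) := by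
    have : ε₁ * ε ≤ ε / 40 := by nlinarith
    linarith
  have hmW : 0 < (m : ℝ) * W := by positivity
  have hE1 : (m : ℝ) * r₁ * C₁ - μ * W * w₀ + m * ((1 + ε₁) * W) - Λ * W * w₀ ≤
      (m : ℝ) * r₁ * C₁ + m * W * (3 * ε₁ + ε₁ * ε / 2 - ε / 4) := by
    nlinarith [hkey]
  have hE2 : (m : ℝ) * W * (3 * ε₁ + ε₁ * ε / 2 - ε / 4) ≤ -((m : ℝ) * W * (13 * ε / 80)) := by
    have := mul_le_mul_of_nonneg_left hbr hmW.le
    linarith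
  have hmr0 : 0 < (m : ℝ) * r₁ := by positivity
  have h3 : (m : ℝ) * W * (13 * ε / 80) = (m : ℝ) * r₁ * ((13 / 80) * (ε * L)) := by
    rw [hW]; ring
  have h4 : (m : ℝ) * r₁ * C₁ < (m : ℝ) * r₁ * ((13 / 80) * (ε * L)) := by
    apply mul_lt_mul_of_pos_left _ hmr0
    nlinarith
  linarith

set_option maxHeartbeats 1000000 in
-- a long §11-type assembly; the heartbeat budget is for the single `theorem` command
/-- **No approximation class with a partial archimedean share is infinite** (Ridout's theorem
over `ℚ`, class form, with `|ρ| ≤ c₀ den(ρ)^{-μ}` at `∞` and `min(1,|ρ − θ_p|_p) ≤ den(ρ)^{-ν_p}`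
at `p ∈ S`, `μ + Σ ν_p ≥ 2 + ε/2`): Schmidt's §11 run with the several-targets Index Theorem,
Roth's Lemma, and the `S ∪ {∞}` estimates of Bombieri–Gubler 6.2.9 / §6.4 — see the module
docstring. [cite: BombieriGubler2006, Thm. 6.2.3 and §6.4 (proof of Thm. 6.4.1) with 6.2.5–6.2.6] -/
theorem false_of_class_abs (S : Finset Nat.Primes) (Q : Nat.Primes → ℤ[X])
    (hQm : ∀ p ∈ S, (Q p).Monic) (hQd : ∀ p ∈ S, 1 ≤ (Q p).natDegree)
    (θ : ∀ p : Nat.Primes, @PadicAlgCl (p : ℕ) ⟨p.2⟩)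
    (hθ : ∀ p ∈ S, Polynomial.aeval (θ p) (Q p) = 0)
    (c₀ : ℕ) (hc₀ : 1 ≤ c₀) {ε : ℝ} (hε : 0 < ε)
    (μ : ℝ) (hμ : 0 ≤ μ) (ν : Nat.Primes → ℝ) (hν : ∀ p, 0 ≤ ν p)
    (hsum : 2 + ε / 2 ≤ μ + ∑ p ∈ S, ν p)
    (hsupply : ∀ N : ℕ, ∃ ρ : ℚ, N < ρ.den ∧ (|(ρ : ℝ)| ≤ c₀ * (ρ.den : ℝ) ^ (-μ) ∧
      ∀ p ∈ S, min 1 ‖(ρ : @PadicAlgCl (p : ℕ) ⟨p.2⟩) - θ p‖ ≤ (ρ.den : ℝ) ^ (-(ν p)))) :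
    False := by
  classical
  have _inst (p : Nat.Primes) : Fact (p : ℕ).Prime := ⟨p.2⟩
  /- (ii) `ε₁` -/
  set ε₁ : ℝ := min ε 1 / 40 with hε₁_def
  have hmin0 : 0 < min ε 1 := lt_min hε one_pos
  have hε₁0 : 0 < ε₁ := by positivity
  have hε₁ε : ε₁ ≤ ε / 40 := by
    rw [hε₁_def]; exact div_le_div_of_nonneg_right (min_le_left _ _) (by norm_num)
  have hε₁1 : ε₁ ≤ 1 / 40 := by rw [hε₁_def]; linarith [min_le_right ε 1]
  have hε₁12 : ε₁ < 1 / 12 := by linarith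
  /- the targets: `Q_p` for `p ∈ S` and `X` (root `0`) for the place `∞` -/
  set Qf : Option ↥S → ℤ[X] := fun o => o.elim Polynomial.X fun p => Q p.1 with hQf
  have hQfm : ∀ o, (Qf o).Monic := by
    rintro (_ | p)
    · exact Polynomial.monic_X
    · exact hQm p.1 p.2
  have hQfd : ∀ o, 1 ≤ (Qf o).natDegree := by
    rintro (_ | p)
    · simp [hQf]
    · exact hQd p.1 p.2
  obtain ⟨B₀, hB₀1, h7A⟩ := Ridout.indexTheorem Qf hQfm hQfd
  set Dlog : ℝ := Real.log (4 * ∑ o, (Qf o).natDegree) with hDlog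
  /- (iii) `m` and `ω` -/
  set m : ℕ := ⌈16 / ε₁ ^ 2 * Dlog⌉₊ + 2 with hm_def
  have hm2 : 2 ≤ m := Nat.le_add_left _ _
  have hm0 : 0 < m := lt_of_lt_of_le two_pos hm2
  have hmR2 : (2 : ℝ) ≤ m := by exact_mod_cast hm2
  have hmlog : 16 / ε₁ ^ 2 * Dlog < m := by
    rw [hm_def]; push_cast
    have := Nat.le_ceil (16 / ε₁ ^ 2 * Dlog); linarith
  set ω : ℝ := omega m ε₁ with hω_def
  have hω0 : 0 < ω := omega_pos hε₁0
  have hω1 : ω < 1 := (omega_le_half' hm2 hε₁0.le (by linarith)).trans_lt (by linarith)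
  have h2ω : 1 < 2 / ω := by rw [lt_div_iff₀ hω0]; linarith
  /- the constants `B`, `C₁ = log(4 B c₀)` -/
  set B : ℝ := (B₀ : ℝ) with hB_def
  have hB1 : 1 ≤ B := by rw [hB_def]; exact_mod_cast hB₀1
  have hc₀R : (1 : ℝ) ≤ c₀ := by exact_mod_cast hc₀
  set C₁ : ℝ := Real.log (4 * B * c₀) with hC₁_def
  have hC₁0 : 0 ≤ C₁ := Real.log_nonneg (by nlinarith)
  /- (iv)-(v) the chain `ρ_h = p_h/q_h`, `q_h > T` -/
  set T : ℝ := max (max ((B ^ m) ^ ω⁻¹) (Real.exp (8 * (C₁ + 1) / ε)))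
    (max (((2 : ℝ) ^ (3 * m)) ^ ω⁻¹) 2) with hT_def
  set N₀ : ℕ := ⌈T⌉₊ with hN₀_def
  obtain ⟨g, hg_prop, hg_N₀, hg_grow, hg_mono⟩ := exists_chain hsupply N₀ (2 / ω)
  set pn : Fin m → ℤ := fun h => (g h).num with hpn_def
  set q : Fin m → ℕ := fun h => (g h).den with hq_def
  have hq0 : ∀ h, 0 < q h := fun h => (g h).den_pos
  have hqR0 : ∀ h, (0 : ℝ) < q h := fun h => by exact_mod_cast hq0 h
  have hcop : ∀ h, Nat.Coprime (pn h).natAbs (q h) := fun h => (g h).reduced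
  have hnum : ∀ h, |(pn h : ℝ) / q h| ≤ c₀ * (q h : ℝ) ^ (-μ) := fun h => by
    have h1 := (hg_prop h).1; rwa [Rat.cast_def] at h1
  have hclass : ∀ h : Fin m, ∀ p ∈ S, min 1 ‖((g h : ℚ) : PadicAlgCl (p : ℕ)) - θ p‖ ≤
      (q h : ℝ) ^ (-(ν p)) := fun h p hp => (hg_prop h).2 p hp
  have hqT : ∀ h : Fin m, T < q h := fun h =>
    (Nat.le_ceil T).trans_lt (by exact_mod_cast hg_N₀ h)
  have hq2 : ∀ h, (2 : ℝ) < q h := fun h =>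
    lt_of_le_of_lt ((le_max_right _ _).trans (le_max_right _ _)) (hqT h)
  have key : ∀ {a t x : ℝ}, 0 ≤ a → 0 < t → a ^ t⁻¹ < x → a < x ^ t := by
    intro a t x ha ht h
    calc a = (a ^ t⁻¹) ^ t := (Real.rpow_inv_rpow ha ht.ne').symm
      _ < x ^ t := Real.rpow_lt_rpow (Real.rpow_nonneg ha _) h ht
  have hqB : ∀ h, B ^ m < (q h : ℝ) ^ ω := fun h =>
    key (by positivity) hω0 (lt_of_le_of_lt ((le_max_left _ _).trans (le_max_left _ _)) (hqT h))
  have hqexp : ∀ h, Real.exp (8 * (C₁ + 1) / ε) < (q h : ℝ) := fun h =>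
    lt_of_le_of_lt ((le_max_right _ _).trans (le_max_left _ _)) (hqT h)
  have hq3m : ∀ h, (2 : ℝ) ^ (3 * m) ≤ (q h : ℝ) ^ ω := fun h =>
    (key (by positivity) hω0
      (lt_of_le_of_lt ((le_max_left _ _).trans (le_max_right _ _)) (hqT h))).le
  -- monotonicity and growth of the denominators
  have hgmono : StrictMono fun k => (g k).den := strictMono_nat_of_lt_succ hg_mono
  have hqlt : ∀ h h' : Fin m, h < h' → q h < q h' := fun h h' hh => hgmono hh
  have hqle : ∀ h h' : Fin m, h ≤ h' → q h ≤ q h' := fun h h' hh => hgmono.monotone hh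
  have hLgrow : ∀ h h' : Fin m, (h : ℕ) + 1 = h' →
      (2 / ω) * Real.log (q h) ≤ Real.log (q h') := by
    intro h h' hh
    have h0 : ((g h).den : ℝ) ^ (2 / ω) ≤ (g ((h : ℕ) + 1)).den := hg_grow h
    rw [hh] at h0
    have h1 := Real.log_le_log (Real.rpow_pos_of_pos (hqR0 h) _) h0
    rwa [Real.log_rpow (hqR0 h)] at h1
  have hL0 : ∀ h, 0 < Real.log (q h) := fun h => Real.log_pos (by linarith [hq2 h])
  /- (vi)-(vii) the degrees `r_h` -/
  set i₀ : Fin m := ⟨0, hm0⟩ with hi₀_def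
  obtain ⟨r, hr0, hR1, hR2, hR3, hR4, hR5⟩ :=
    exists_degrees hm0 q hq2 hqle hqlt hω0 hLgrow hε₁0 (by linarith)
  set r₁ : ℕ := r i₀ with hr₁_def
  have hr₁pos : 0 < r₁ := hr0 i₀
  have hrsum : ∑ h, r h ≤ m * r₁ :=
    calc ∑ h, r h ≤ ∑ _h : Fin m, r₁ := Finset.sum_le_sum fun h _ => hR3 h
      _ = m * r₁ := by simp
  have hsumR : ((∑ h, r h : ℕ) : ℝ) ≤ m * r₁ := by exact_mod_cast hrsum
  /- the auxiliary polynomial of the several-targets Index Theorem -/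
  set rN : ℕ → ℕ := fun h => if hh : h < m then r ⟨h, hh⟩ else 1 with hrN_def
  have hrN : ∀ h : Fin m, rN h = r h := fun h => by simp [hrN_def, h.isLt]
  have hrNfun : (fun h : Fin m => rN h) = r := funext hrN
  have hrN0 : ∀ h, h < m → 0 < rN h := fun h hh => by
    simp only [hrN_def, dif_pos hh]; exact hr0 _
  obtain ⟨P, hP0, hPdeg', hPind', hPht'⟩ := h7A ε₁ hε₁0 m hmlog rN hrN0
  have hPdeg : ∀ h, P.degreeOf h ≤ r h := fun h => hrN h ▸ hPdeg' h
  have hPind0 : IndexGe P (fun _ : Fin m => (0 : ℝ)) r (m / 2 * (1 - ε₁)) := by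
    have := hPind' none ℝ 0 (by simp [hQf]); rwa [hrNfun] at this
  have hPindp : ∀ p (hp : p ∈ S),
      IndexGe P (fun _ : Fin m => θ p) r (m / 2 * (1 - ε₁)) := by
    intro p hp
    have := hPind' (some ⟨p, hp⟩) (PadicAlgCl (p : ℕ)) (θ p) (by
      show Polynomial.aeval (θ p) (Q p) = 0
      convert hθ p hp)
    rwa [hrNfun] at this
  have hPhtB : (height P : ℝ) ≤ B ^ (∑ h, r h) := by
    have h1 : ((height P : ℕ) : ℝ) ≤ ((B₀ ^ (∑ h : Fin m, rN h) : ℕ) : ℝ) := by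
      exact_mod_cast hPht'
    rw [hB_def]
    simpa [hrN] using h1
  /- Roth's lemma: some `P_J(ρ) ≠ 0` with `wt J ≤ ε₁` -/
  have hPhtω : (height P : ℝ) ≤ (q i₀ : ℝ) ^ (omega m ε₁ * (r i₀ : ℕ)) := by
    have h2 : B ^ (∑ h, r h) ≤ B ^ (m * r₁) := pow_le_pow_right₀ hB1 hrsum
    have h4 : (B ^ m) ^ r₁ < ((q i₀ : ℝ) ^ ω) ^ r₁ :=
      pow_lt_pow_left₀ (hqB i₀) (by positivity) hr₁pos.ne'
    have h5 : ((q i₀ : ℝ) ^ ω) ^ r₁ = (q i₀ : ℝ) ^ (ω * (r i₀ : ℕ)) := by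
      rw [hr₁_def, Real.rpow_mul (hqR0 i₀).le, Real.rpow_natCast]
    rw [← h5, ← pow_mul] at *
    linarith
  obtain ⟨J, hJwt, hJne⟩ := rothLemma m hm0 ε₁ hε₁0 hε₁12 r hr0 hR4 pn q hq0 hcop hR5 hq3m P
    hP0 hPdeg hPhtω
  /- the polynomial `T = P_J`: degrees, height, index at the targets -/
  set PJ : MvPolynomial (Fin m) ℤ := hasseD J P with hPJ_def
  have hPJdeg : ∀ h, PJ.degreeOf h ≤ r h := fun h =>
    (degreeOf_hasseD_le h J P).trans ((Nat.sub_le _ _).trans (hPdeg h))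
  have hPJht : (height PJ : ℝ) ≤ 2 ^ (∑ h, r h) * height P := by
    exact_mod_cast height_hasseD_le J P r hPdeg
  set w₀ : ℝ := m / 2 * (1 - ε₁) - ε₁ with hw₀_def
  have hw₀' : m / 2 * (1 - ε₁) - wt r J ≥ w₀ := by rw [hw₀_def]; linarith
  have hw₀low : (m : ℝ) / 2 * (1 - 2 * ε₁) ≤ w₀ := by
    have h1 : w₀ - (m : ℝ) / 2 * (1 - 2 * ε₁) = ε₁ * ((m : ℝ) / 2 - 1) := by rw [hw₀_def]; ring
    have h2 : 0 ≤ ε₁ * ((m : ℝ) / 2 - 1) := mul_nonneg hε₁0.le (by linarith)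
    linarith
  have hw₀0 : 0 ≤ w₀ := le_trans (mul_nonneg (by positivity) (by linarith)) hw₀low
  have hPJind0 : IndexGe PJ (fun _ : Fin m => (0 : ℝ)) r w₀ := (hPind0.hasseD J).mono hw₀'
  have hPJindp : ∀ p (hp : p ∈ S), IndexGe PJ (fun _ : Fin m => θ p) r w₀ := fun p hp =>
    ((hPindp p hp).hasseD J).mono hw₀'
  /- the non-zero integer `N = q₁^{r₁}⋯q_m^{r_m} P_J(ρ)` -/
  set L : ℝ := Real.log (q i₀) with hL_def
  set W : ℝ := (r₁ : ℝ) * L with hW_def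
  have hW0 : 0 < W := mul_pos (by exact_mod_cast hr₁pos) (hL0 i₀)
  have hR1W : ∀ h, W ≤ r h * Real.log (q h) := fun h => by rw [hW_def, hr₁_def]; exact hR1 h
  set ρQ : Fin m → ℚ := fun h => (pn h : ℚ) / q h with hρQ_def
  have hρQg : ∀ h, ρQ h = g h := fun h => Rat.num_div_den (g h)
  obtain ⟨N, hN⟩ := exists_int_aeval_eq PJ r hPJdeg pn q hq0
  have hfunR : (fun h => ((ρQ h : ℚ) : ℝ)) = fun h => (pn h : ℝ) / q h := by
    funext h; rw [hρQ_def]; push_cast; rfl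
  have hvalR : aeval (fun h => (pn h : ℝ) / q h) PJ = ((aeval ρQ PJ : ℚ) : ℝ) := by
    rw [← hfunR, aeval_ratCast]
  have hNR : ((aeval ρQ PJ : ℚ) : ℝ) * ∏ h, (q h : ℝ) ^ (r h) = N := by
    have := congrArg (fun x : ℚ => (x : ℝ)) hN
    push_cast at this; exact this
  have hprodq0 : 0 < ∏ h, (q h : ℝ) ^ (r h) := prod_pos fun h _ => pow_pos (hqR0 h) _
  have hN0 : N ≠ 0 := by
    intro hN0
    rw [hN0, Int.cast_zero, mul_eq_zero] at hNR
    rcases hNR with h | h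
    · exact hJne (by rw [hvalR, h])
    · exact hprodq0.ne' h
  /- the product formula: `1 ≤ |T| Π q_h^{r_h} Π_p min(1, |T|_p)` -/
  have hNp : ∀ p ∈ S, ‖(N : PadicAlgCl (p : ℕ))‖ ≤
      min 1 ‖aeval (fun h => ((ρQ h : ℚ) : PadicAlgCl (p : ℕ))) PJ‖ := by
    intro p hp
    refine le_min (IsUltrametricDist.norm_intCast_le_one _ N) ?_
    have h1 : ((aeval ρQ PJ : ℚ) : PadicAlgCl (p : ℕ)) *
        ∏ h, ((q h : ℕ) : PadicAlgCl (p : ℕ)) ^ (r h) = (N : PadicAlgCl (p : ℕ)) := by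
      have := congrArg (fun x : ℚ => (x : PadicAlgCl (p : ℕ))) hN
      push_cast at this; exact this
    rw [← h1, ← aeval_ratCast, norm_mul, norm_prod]
    refine mul_le_of_le_one_right (norm_nonneg _) (prod_le_one (fun _ _ => by positivity) ?_)
    intro h _
    rw [norm_pow]
    have hqn := IsUltrametricDist.norm_natCast_le_one (PadicAlgCl (p : ℕ)) (q h)
    exact pow_le_one₀ (norm_nonneg _) hqn
  have hlower : 1 ≤ |aeval (fun h => (pn h : ℝ) / q h) PJ| * (∏ h, (q h : ℝ) ^ (r h)) *
      ∏ p ∈ S, min 1 ‖aeval (fun h => ((ρQ h : ℚ) : PadicAlgCl (p : ℕ))) PJ‖ := by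
    have h1 := one_le_abs_mul_prod_norm S hN0
    have h2 : |(N : ℝ)| = |aeval (fun h => (pn h : ℝ) / q h) PJ| * ∏ h, (q h : ℝ) ^ (r h) := by
      rw [← hNR, ← hvalR, abs_mul, abs_of_pos hprodq0]
    rw [h2] at h1
    refine h1.trans (mul_le_mul_of_nonneg_left ?_ (by positivity))
    exact prod_le_prod (fun p _ => norm_nonneg _) hNp
  /- the upper bounds -/
  -- weights: `Π (q_h^{-s})^{i_h} ≤ e^{-s W wt(i)} ≤ e^{-s W w₀}` beyond the index
  have hmono : ∀ (s : ℝ), 0 ≤ s → ∀ i : Fin m →₀ ℕ, w₀ ≤ wt r i →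
      ∏ h, ((q h : ℝ) ^ (-s)) ^ (i h) ≤ Real.exp (-(s * W * w₀)) := by
    intro s hs i hi
    refine (prod_rpow_le_exp r hr0 (fun h => (q h : ℝ)) hqR0 W hR1W hs i).trans ?_
    rw [Real.exp_le_exp]
    have : s * W * w₀ ≤ s * W * wt r i := mul_le_mul_of_nonneg_left hi (by positivity)
    linarith
  -- (∞): `|T| ≤ Π(r_h+1) |P_J| c₀^{Σr} e^{-μ W w₀}`
  have hU0 : |aeval (fun h => (pn h : ℝ) / q h) PJ| ≤
      (∏ h, ((r h : ℝ) + 1)) * height PJ *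
        ((c₀ : ℝ) ^ (∑ h, r h) * Real.exp (-(μ * W * w₀))) := by
    refine abs_aeval_le_of_indexGe_zero PJ r hPJdeg w₀ hPJind0 _
      (fun h => (c₀ : ℝ) * (q h : ℝ) ^ (-μ)) hnum _ (by positivity) (fun i hir hwi => ?_)
    simp_rw [mul_pow]
    rw [prod_mul_distrib, prod_pow_eq_pow_sum]
    exact mul_le_mul (pow_le_pow_right₀ hc₀R (sum_le_sum fun h _ => hir h))
      (hmono μ hμ i hwi) (prod_nonneg fun h _ => by positivity) (by positivity)
  -- (p): `min(1, |T|_p) ≤ e^{-ν_p W w₀}`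
  have hUp : ∀ p ∈ S, min 1 ‖aeval (fun h => ((ρQ h : ℚ) : PadicAlgCl (p : ℕ))) PJ‖ ≤
      Real.exp (-(ν p * W * w₀)) := by
    intro p hp
    rcases (hν p).eq_or_lt with h0 | hpos
    · rw [← h0]
      simp only [zero_mul, neg_zero, Real.exp_zero]
      exact min_le_left _ _
    · have hδ : ∀ h, ‖((ρQ h : ℚ) : PadicAlgCl (p : ℕ)) - θ p‖ ≤ (q h : ℝ) ^ (-(ν p)) := by
        intro h
        have h1 := hclass h p hp
        rw [hρQg h]
        have hlt1 : (q h : ℝ) ^ (-(ν p)) < 1 :=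
          Real.rpow_lt_one_of_one_lt_of_neg (by linarith [hq2 h]) (by linarith)
        rcases min_le_iff.mp h1 with h2 | h2
        · exact absurd (h2.trans_lt hlt1) (lt_irrefl _)
        · exact h2
      refine le_trans (min_le_right _ _) ?_
      exact norm_aeval_le_of_indexGe PJ r hPJdeg (θ p)
        (norm_root_le_one (Q p) (hQm p hp) (θ p) (hθ p hp)) w₀ (hPJindp p hp) _ _ hδ _
        (by positivity) (fun i _ hwi => hmono _ hpos.le i hwi)
  -- (q): `Π q_h^{r_h} ≤ e^{m (1+ε₁) W}`
  have hUq : ∏ h, (q h : ℝ) ^ (r h) ≤ Real.exp (m * ((1 + ε₁) * W)) := by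
    have h1 : ∏ h, (q h : ℝ) ^ (r h) = Real.exp (∑ h, (r h : ℝ) * Real.log (q h)) := by
      rw [Real.exp_sum]
      refine prod_congr rfl fun h _ => ?_
      rw [← Real.rpow_natCast, Real.rpow_def_of_pos (hqR0 h), mul_comm]
    rw [h1, Real.exp_le_exp]
    calc ∑ h, (r h : ℝ) * Real.log (q h) ≤ ∑ _h : Fin m, (1 + ε₁) * W :=
          sum_le_sum fun h _ => hR2 h
      _ = m * ((1 + ε₁) * W) := by simp
  /- combining: `1 ≤ (4 B c₀)^{m r₁} e^{E'}` -/
  set Λ : ℝ := ∑ p ∈ S, ν p with hΛ_def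
  have hprodp : ∏ p ∈ S, min 1 ‖aeval (fun h => ((ρQ h : ℚ) : PadicAlgCl (p : ℕ))) PJ‖ ≤
      Real.exp (-(Λ * W * w₀)) := by
    have h1 : Real.exp (-(Λ * W * w₀)) = ∏ p ∈ S, Real.exp (-(ν p * W * w₀)) := by
      rw [← Real.exp_sum, hΛ_def]
      congr 1
      rw [sum_mul, sum_mul, ← sum_neg_distrib]
    rw [h1]
    exact prod_le_prod (fun p _ => le_min zero_le_one (norm_nonneg _)) hUp
  -- sizes of the prefactors
  have h2pow : (2 : ℝ) ^ (∑ h, r h) ≤ 2 ^ (m * r₁) := pow_le_pow_right₀ (by norm_num) hrsum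
  have hcard : (∏ h, ((r h : ℝ) + 1)) ≤ 2 ^ (m * r₁) := by
    have h1 : ((∏ h, (r h + 1) : ℕ) : ℝ) ≤ ((2 ^ (∑ h, r h) : ℕ) : ℝ) := by
      exact_mod_cast prod_succ_le_two_pow_sum r
    push_cast at h1
    exact h1.trans h2pow
  have hhtPJ : (height PJ : ℝ) ≤ 2 ^ (m * r₁) * B ^ (m * r₁) := hPJht.trans
    (mul_le_mul h2pow (hPhtB.trans (pow_le_pow_right₀ hB1 hrsum)) (by positivity) (by positivity))
  have hc₀pow : (c₀ : ℝ) ^ (∑ h, r h) ≤ (c₀ : ℝ) ^ (m * r₁) := pow_le_pow_right₀ hc₀R hrsum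
  have hX : (∏ h, ((r h : ℝ) + 1)) * height PJ * ((c₀ : ℝ) ^ (∑ h, r h)) ≤
      (4 * B * c₀) ^ (m * r₁) := by
    calc (∏ h, ((r h : ℝ) + 1)) * height PJ * ((c₀ : ℝ) ^ (∑ h, r h))
        ≤ 2 ^ (m * r₁) * (2 ^ (m * r₁) * B ^ (m * r₁)) * (c₀ : ℝ) ^ (m * r₁) := by
          gcongr
      _ = (4 * B * c₀) ^ (m * r₁) := by
          rw [mul_pow, mul_pow, show (4 : ℝ) = 2 * 2 by norm_num, mul_pow]; ring
  have hX' : (4 * B * c₀) ^ (m * r₁) = Real.exp ((m * r₁ : ℕ) * C₁) := by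
    rw [Real.exp_nat_mul, hC₁_def, Real.exp_log (by positivity)]
  -- the main inequality `1 ≤ exp(E)`
  set E : ℝ := (m * r₁ : ℕ) * C₁ - μ * W * w₀ + m * ((1 + ε₁) * W) - Λ * W * w₀ with hE_def
  have hmain : (1 : ℝ) ≤ Real.exp E := by
    calc (1 : ℝ) ≤ |aeval (fun h => (pn h : ℝ) / q h) PJ| * (∏ h, (q h : ℝ) ^ (r h)) *
          ∏ p ∈ S, min 1 ‖aeval (fun h => ((ρQ h : ℚ) : PadicAlgCl (p : ℕ))) PJ‖ := hlower
      _ ≤ ((∏ h, ((r h : ℝ) + 1)) * height PJ *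
            ((c₀ : ℝ) ^ (∑ h, r h) * Real.exp (-(μ * W * w₀)))) *
          Real.exp (m * ((1 + ε₁) * W)) * Real.exp (-(Λ * W * w₀)) := by
          refine mul_le_mul (mul_le_mul hU0 hUq hprodq0.le (by positivity)) hprodp
            (prod_nonneg fun p _ => le_min zero_le_one (norm_nonneg _)) (by positivity)
      _ = ((∏ h, ((r h : ℝ) + 1)) * height PJ * ((c₀ : ℝ) ^ (∑ h, r h))) *
          (Real.exp (-(μ * W * w₀)) * Real.exp (m * ((1 + ε₁) * W)) *
            Real.exp (-(Λ * W * w₀))) := by ring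
      _ ≤ (4 * B * c₀) ^ (m * r₁) *
          (Real.exp (-(μ * W * w₀)) * Real.exp (m * ((1 + ε₁) * W)) *
            Real.exp (-(Λ * W * w₀))) := by
          gcongr
      _ = Real.exp E := by
          rw [hX', hE_def, ← Real.exp_add, ← Real.exp_add, ← Real.exp_add]
          ring_nf
  /- the exponent is negative: contradiction -/
  have hL : 8 * (C₁ + 1) < ε * L := by
    have h1 : 8 * (C₁ + 1) / ε < Real.log (q i₀) :=
      (Real.lt_log_iff_exp_lt (hqR0 i₀)).mpr (hqexp i₀)
    rw [div_lt_iff₀ hε] at h1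
    calc 8 * (C₁ + 1) < Real.log (q i₀) * ε := h1
      _ = ε * L := by rw [hL_def, mul_comm]
  have hE : E < 0 :=
    exponent_neg_abs hm2 hr₁pos hε hε₁0 hε₁ε hε₁1 hC₁0 hL (hL0 i₀) hsum hw₀low hw₀0
  linarith [Real.exp_lt_one_iff.mpr hE]

end Ridout

end Literature.NumberTheory.DiophantineApproximation

end
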